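import Mathlib
import HarnessLib

/-!
# `ContinuumLegGivenGap` (stmt-QuantumFields-15828), line `Sketch`, reshape 18c: `stub_csclEndgame` — the real-variable endgame of the (CSCL) assembly

Support file for the crux item stmt-QuantumFields-15828 (registered glue stub `stub_csclEndgame` of line
`Sketch`, reshape 18c). An elementary inequality between real numbers closing the Cauchy–Schwarz clustering
assembly: the per-datum matching `‖OS − P‖ ≤ ε₁`, the uniform lattice Cauchy–Schwarz bound
`‖P‖ ≤ e √PX √PY + τfh`, the variance matchings `|DF − PX|, |DH − PY| ≤ ε₂`, the rate comparison
`0 ≤ e ≤ E ≤ 1` and the uniform bounds `DF ≤ BF`, `DH ≤ BH` combine to `‖OS‖ ≤ E √DF √DH + ε` under the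
budget `ε₁ + τfh + √ε₂ (√BF + √BH) + ε₂ ≤ ε`.

The only non-linear ingredients are `√PX ≤ √(DF + ε₂) ≤ √DF + √ε₂` (monotonicity and subadditivity of the
real square root; no sign condition on `PX` is needed since `Real.sqrt` vanishes on negatives), the product
estimate `e √PX √PY ≤ E (√DF + √ε₂) (√DH + √ε₂)` and the expansion `√ε₂ · √ε₂ = ε₂`.

No definitions, no facts; Mathlib only. [folklore]
-/

noncomputable section

namespace Summit.QuantumFields.YangMills.Theorems.ContinuumLegGivenGap

/-- **Subadditivity of the real square root** (no sign condition on the first argument):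
`√(x + y) ≤ √x + √y` for `0 ≤ y`. [folklore] -/
theorem csclEndgame_sqrt_add_le (x y : ℝ) (hy : 0 ≤ y) :
    Real.sqrt (x + y) ≤ Real.sqrt x + Real.sqrt y := by
  rcases le_or_gt 0 x with hx | hx
  · rw [Real.sqrt_le_left (add_nonneg (Real.sqrt_nonneg x) (Real.sqrt_nonneg y))]
    nlinarith [Real.sq_sqrt hx, Real.sq_sqrt hy, Real.sqrt_nonneg x, Real.sqrt_nonneg y]
  · calc Real.sqrt (x + y) ≤ Real.sqrt y := Real.sqrt_le_sqrt (by linarith)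
      _ ≤ Real.sqrt x + Real.sqrt y := le_add_of_nonneg_left (Real.sqrt_nonneg x)

/-- `stub_csclEndgame` — **the real-variable endgame of the (CSCL) assembly** (reshape 18c glue, elementary): the
per-datum matching (`‖OS − P‖ ≤ ε₁`), the uniform lattice Cauchy–Schwarz bound (`‖P‖ ≤ e √PX √PY + τfh`), the
variance matchings (`|DF − PX|, |DH − PY| ≤ ε₂`), the rate comparison `e ≤ E ≤ 1` and the uniform bounds `DF ≤ BF`,
`DH ≤ BH` combine to `‖OS‖ ≤ E √DF √DH + ε` under the budget `ε₁ + τfh + √ε₂ (√BF + √BH) + ε₂ ≤ ε`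
(`√PX ≤ √DF + √ε₂`). [folklore] -/
theorem stub_csclEndgame :
    ∀ (OS P : ℂ) (PX PY DF DH BF BH e E τfh ε₁ ε₂ ε : ℝ),
      ‖OS - P‖ ≤ ε₁ → ‖P‖ ≤ e * Real.sqrt PX * Real.sqrt PY + τfh → |DF - PX| ≤ ε₂ → |DH - PY| ≤ ε₂ →
      0 ≤ e → e ≤ E → E ≤ 1 → 0 ≤ DF → 0 ≤ DH → DF ≤ BF → DH ≤ BH → 0 ≤ ε₂ →
      ε₁ + τfh + (Real.sqrt ε₂ * (Real.sqrt BF + Real.sqrt BH) + ε₂) ≤ ε →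
      ‖OS‖ ≤ E * Real.sqrt DF * Real.sqrt DH + ε := by
  intro OS P PX PY DF DH BF BH e E τfh ε₁ ε₂ ε hOS hP hX hY he heE hE1 _hDF _hDH hBF hBH hε₂ hbud
  -- (1) `‖OS‖ ≤ ‖P‖ + ε₁`
  have h1 : ‖OS‖ ≤ ‖P‖ + ε₁ := by
    have h := norm_sub_norm_le OS P
    linarith
  -- (2) `√PX ≤ √DF + √ε₂`, `√PY ≤ √DH + √ε₂`
  have hPX : PX ≤ DF + ε₂ := by
    have h := (abs_le.mp hX).1
    linarith
  have hPY : PY ≤ DH + ε₂ := by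
    have h := (abs_le.mp hY).1
    linarith
  have hsX : Real.sqrt PX ≤ Real.sqrt DF + Real.sqrt ε₂ :=
    (Real.sqrt_le_sqrt hPX).trans (csclEndgame_sqrt_add_le DF ε₂ hε₂)
  have hsY : Real.sqrt PY ≤ Real.sqrt DH + Real.sqrt ε₂ :=
    (Real.sqrt_le_sqrt hPY).trans (csclEndgame_sqrt_add_le DH ε₂ hε₂)
  -- (3) the product estimate
  have hE0 : 0 ≤ E := he.trans heE
  have h3 : e * Real.sqrt PX * Real.sqrt PY ≤
      E * ((Real.sqrt DF + Real.sqrt ε₂) * (Real.sqrt DH + Real.sqrt ε₂)) := by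
    rw [mul_assoc]
    exact mul_le_mul heE
      (mul_le_mul hsX hsY (Real.sqrt_nonneg _) (add_nonneg (Real.sqrt_nonneg _) (Real.sqrt_nonneg _)))
      (mul_nonneg (Real.sqrt_nonneg _) (Real.sqrt_nonneg _)) hE0
  -- (4) expand, using `√ε₂ * √ε₂ = ε₂`, and bound the cross terms
  have h4 : E * ((Real.sqrt DF + Real.sqrt ε₂) * (Real.sqrt DH + Real.sqrt ε₂)) =
      E * Real.sqrt DF * Real.sqrt DH + E * (Real.sqrt ε₂ * (Real.sqrt DF + Real.sqrt DH) + ε₂) := by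
    linear_combination E * Real.mul_self_sqrt hε₂
  have hbr : E * (Real.sqrt ε₂ * (Real.sqrt DF + Real.sqrt DH) + ε₂) ≤
      Real.sqrt ε₂ * (Real.sqrt BF + Real.sqrt BH) + ε₂ := by
    have hb0 : 0 ≤ Real.sqrt ε₂ * (Real.sqrt DF + Real.sqrt DH) + ε₂ := by positivity
    have hmono : Real.sqrt ε₂ * (Real.sqrt DF + Real.sqrt DH) ≤
        Real.sqrt ε₂ * (Real.sqrt BF + Real.sqrt BH) :=
      mul_le_mul_of_nonneg_left (add_le_add (Real.sqrt_le_sqrt hBF) (Real.sqrt_le_sqrt hBH))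
        (Real.sqrt_nonneg _)
    calc E * (Real.sqrt ε₂ * (Real.sqrt DF + Real.sqrt DH) + ε₂)
        ≤ 1 * (Real.sqrt ε₂ * (Real.sqrt DF + Real.sqrt DH) + ε₂) :=
          mul_le_mul_of_nonneg_right hE1 hb0
      _ ≤ Real.sqrt ε₂ * (Real.sqrt BF + Real.sqrt BH) + ε₂ := by linarith
  -- (5) sum up
  linarith

end Summit.QuantumFields.YangMills.Theorems.ContinuumLegGivenGap

end
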